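import Summits.ResolutionOfSingularities.ResolutionOfSingularities.Theorems.CurveChainCutKernels2
import HarnessLib

/-!
# CurveChainCutKernels3 — decomp-res node «CurveChainCut» (lens-4 g37, critic row 209 CLEARED), tree file 3/4 of the node

Content VERBATIM from the decomp-res lens-4 g37 node `HOME/decomp-res-lens-4/g37/CurveChainCut.lean` (pin 33fe29d0;
no carry, imports the landed tree only; namespace `…Theorems.HugValuationCut`); HOME =
run/shared/lean/pub/decomp-res; critic CRITIC-LEDGER row 209 CLEARED; landing orders INBOX 10:47:47Z / :1401 —
provenance, critic text and the lens header in full in the first file of the node, `CurveChainCutKernels`.  `--kind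
proof --supports stmt-ResolutionOfSingularities-28338`.

## This file

§119c (`section CurveLaw`) TOWER LEVEL: δ-DESCENT `exists_regular_curveStage` (δ non-increasing and strictly
dropping while singular, Literature `IsQuadraticTransform.curveDelta_lt`), THE LINE BRIDGE
`followsLineTower_of_regular_curveStage` (`curveLine_step` over Literature
`isRegularLocalRing_and_span_originFamily`), the shift lemmas `curveChain_shift` / `curveChain_dim_eq_one` /
`followsCurveTower_shift`, and THE LAW **`noTower_threefold_followsCurve`** (hyp-free, port-free) closed by the g35
`noTower_threefold_followsLine` BY NAME. Continuation 3/3 of `CurveChainCutKernels` (same namespace / sections of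
the node, cut at the tree's 400-line cap;
section variables / opens replayed): scopes `CurveLaw` — carries `curveChain_step`, `curveChain_finite_base`,
`curveChain_dim_eq_one`, `curveChain_shift`, `followsCurveTower_shift`, `exists_regular_curveStage`,
`followsLineTower_of_regular_curveStage`, `noTower_threefold_followsCurve`, `noTowerWild_threefold_followsCurve`.

[WRITER NOTE (decomp-res writer g13): file split only, at the node's own `══ FILE` markers and `section` boundaries
(tree files ≤ 400 lines); namespace, sections, section variables and every declaration exactly as in the lens; the
node's two `set_option linter.…` lines, `noncomputable section`, the namespace-level `open` lines and `universe u`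
are replayed in every part (critic rider).]

(Sources: Kollar2007 §1.4 (Alg. 1.100, Thm. 1.101); CossartPiltant2008 Lemma 4.3 (3), Prop. 4.4; Matsumura1987 Thms.
14.2, 14.3, 17.8, 32.4; CossartJannsenSaito2020 §6; Hironaka1964 Ch. III; Hauser2010Kangaroo; StacksProject 07PJ / 0C4N / 032E.)
-/

set_option linter.dupNamespace false
set_option linter.unusedSectionVars false

noncomputable section

open CategoryTheory AlgebraicGeometry IsLocalRing TopologicalSpace
open Literature.AlgebraicGeometry.Resolution
open Summit.ResolutionOfSingularities.ResolutionOfSingularities.Theorems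
open WeakOrderReduction ForcedTowerClasses DivergentTowerClasses MonomialTowerClasses
open HugDimensionClasses HugDimensionKernels SurfaceShadowClasses SurfaceShadowKernels
open NearPointCut (SingularClass)
open Scheme.IdealSheafData (vanishingIdeal)
open scoped BigOperators

universe u

namespace Summit.ResolutionOfSingularities.ResolutionOfSingularities.Theorems.HugValuationCut

section CurveLaw

variable {k : Type} [Field k]

/-! ### §119c tower level: δ-descent, the line bridge, the law -/

/-- **one blow-up step along a curve chain of a forced tower** (tower form of `curveChain_stage_step`): dimension one and
finite normalisation PERSIST, `δ` does not increase, and `δ` stalls only at a regular germ. (Sources: Kollar2007,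
§1.4, Thm. 1.101.) -/
theorem curveChain_step (T : ForcedTower) (g : T.St 0 ⟶ Spec (.of k)) (hB : IsBase (T.St 0) g) (m : ℕ)
    (𝔮 : ∀ i, Ideal (lineRing T i 0))
    (h𝔮 : ∀ i, m ≤ i → (𝔮 i).IsPrime ∧ 𝔮 i ≠ maximalIdeal (lineRing T i 0) ∧ (𝔮 (i + 1)).comap (lineMap T i 0) = 𝔮 i)
    (i : ℕ) (hi : m ≤ i) (hdi : ringKrullDim (lineRing T i 0 ⧸ 𝔮 i) = 1)
    (hfi : Module.Finite (lineRing T i 0 ⧸ 𝔮 i)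
      (integralClosure (lineRing T i 0 ⧸ 𝔮 i) (FractionRing (lineRing T i 0 ⧸ 𝔮 i)))) :
    ringKrullDim (lineRing T (i + 1) 0 ⧸ 𝔮 (i + 1)) = 1 ∧
      Module.Finite (lineRing T (i + 1) 0 ⧸ 𝔮 (i + 1))
        (integralClosure (lineRing T (i + 1) 0 ⧸ 𝔮 (i + 1)) (FractionRing (lineRing T (i + 1) 0 ⧸ 𝔮 (i + 1)))) ∧
      branchDelta (lineRing T (i + 1) 0) (𝔮 (i + 1)) ≤ branchDelta (lineRing T i 0) (𝔮 i) ∧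
      (branchDelta (lineRing T (i + 1) 0) (𝔮 (i + 1)) = branchDelta (lineRing T i 0) (𝔮 i) →
        IsRegularLocalRing (lineRing T i 0 ⧸ 𝔮 i)) := by
  have hNR := tower_isLocallyNoetherian_isRegular T g hB
  haveI : ∀ i, IsLocallyNoetherian (T.St i) := fun i => (hNR i).1
  obtain ⟨hP, hne, hcomap⟩ := h𝔮 i hi
  obtain ⟨hP', -, -⟩ := h𝔮 (i + 1) (Nat.le_succ_of_le hi)
  -- (elaborated WITHOUT expected type first: the item types `lineRing T i 0` carry `i + 0`, the lemma's stalks `i`;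
  -- unifying the lemma's result type against the goal with metavariables still open makes `whnf` unfold stalks)
  have H := @curveChain_stage_step (T.St i) (T.St (i + 1)) _ (T.π i) (T.pt (i + 1))
    ((T.π (i + 1)).base (T.pt (i + 1 + 1))) (T.pt_map (i + 1)) (tower_isClosed_base T i) (tower_isBlowup_base T i)
    (𝔮 i) hP hne hdi hfi (𝔮 (i + 1)) hP' hcomap
  exact H

/-- **the followed germ at the first stage has finite normalisation** (the stalks of a forced tower over a field are
G-rings: `tower_isGRing_stalk`; a one-dimensional Noetherian local domain that is a G-ring has finite normalisation:
`module_finite_integralClosure_of_isGRing_of_ringKrullDim_eq_one`). (Sources: Matsumura1987, Thm. 32.4; EGA IV 7.8.3.) -/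
theorem curveChain_finite_base (T : ForcedTower) (g : T.St 0 ⟶ Spec (.of k)) (hB : IsBase (T.St 0) g) (m : ℕ)
    (𝔮 : Ideal (lineRing T m 0)) [𝔮.IsPrime] (hd : ringKrullDim (lineRing T m 0 ⧸ 𝔮) = 1) :
    Module.Finite (lineRing T m 0 ⧸ 𝔮) (integralClosure (lineRing T m 0 ⧸ 𝔮) (FractionRing (lineRing T m 0 ⧸ 𝔮))) := by
  haveI : IsLocalRing (lineRing T m 0 ⧸ 𝔮) :=
    IsLocalRing.of_surjective' (Ideal.Quotient.mk 𝔮) Ideal.Quotient.mk_surjective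
  exact module_finite_integralClosure_of_isGRing_of_ringKrullDim_eq_one _
    (isGRing_of_surjective (Ideal.Quotient.mk 𝔮) Ideal.Quotient.mk_surjective (tower_isGRing_stalk T g hB m _)) hd

/-- **dimension one and finite normalisation persist along a curve chain** (induction on the stage with
`curveChain_step`). (Sources: Kollar2007, §1.4.) -/
theorem curveChain_dim_eq_one (T : ForcedTower) (g : T.St 0 ⟶ Spec (.of k)) (hB : IsBase (T.St 0) g) (m : ℕ)
    (𝔮 : ∀ i, Ideal (lineRing T i 0))
    (h𝔮 : ∀ i, m ≤ i → (𝔮 i).IsPrime ∧ 𝔮 i ≠ maximalIdeal (lineRing T i 0) ∧ (𝔮 (i + 1)).comap (lineMap T i 0) = 𝔮 i)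
    (hd : ringKrullDim (lineRing T m 0 ⧸ 𝔮 m) = 1) (i : ℕ) (hi : m ≤ i) :
    ringKrullDim (lineRing T i 0 ⧸ 𝔮 i) = 1 ∧
      Module.Finite (lineRing T i 0 ⧸ 𝔮 i)
        (integralClosure (lineRing T i 0 ⧸ 𝔮 i) (FractionRing (lineRing T i 0 ⧸ 𝔮 i))) := by
  induction i, hi using Nat.le_induction with
  | base =>
    haveI : (𝔮 m).IsPrime := (h𝔮 m le_rfl).1
    exact ⟨hd, curveChain_finite_base T g hB m (𝔮 m) hd⟩
  | succ i hi ih =>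
    obtain ⟨h1, h2, -, -⟩ := curveChain_step T g hB m 𝔮 h𝔮 i hi ih.1 ih.2
    exact ⟨h1, h2⟩

/-- **a curve chain from stage `m` is a curve chain from every later stage `i₀ ≥ m`, in the SHIFTED line rings
`lineRing T i₀ j = 𝒪_{x_{i₀+j}}`** — pure re-indexing: the letter is typed absolutely (`𝔮 i : Ideal (lineRing T i 0)`), and
`lineRing T (i₀ + j) 0`, `lineRing T i₀ j` are the same stalk by `rfl`. [folklore] -/
theorem curveChain_shift (T : ForcedTower) (m : ℕ) (𝔮 : ∀ i, Ideal (lineRing T i 0))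
    (h𝔮 : ∀ i, m ≤ i → (𝔮 i).IsPrime ∧ 𝔮 i ≠ maximalIdeal (lineRing T i 0) ∧ (𝔮 (i + 1)).comap (lineMap T i 0) = 𝔮 i)
    (i₀ : ℕ) (hi₀ : m ≤ i₀) (j : ℕ) :
    (𝔮 (i₀ + j)).IsPrime ∧ 𝔮 (i₀ + j) ≠ maximalIdeal (lineRing T i₀ j) ∧
      (𝔮 (i₀ + j + 1)).comap (lineMap T i₀ j) = 𝔮 (i₀ + j) :=
  h𝔮 (i₀ + j) (hi₀.trans (Nat.le_add_right i₀ j))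

/-- **THE LETTER (CF∞) IS SHIFT-INVARIANT**: a tower that follows a curve germ from some stage follows one (the strict
transform, same primes) from stages beyond any given `m₀`, with dimension one at the new first stage
(`curveChain_dim_eq_one`). [folklore] -/
theorem followsCurveTower_shift (T : ForcedTower) (g : T.St 0 ⟶ Spec (.of k)) (hB : IsBase (T.St 0) g)
    (h : FollowsCurveTower T) (m₀ : ℕ) :
    ∃ m, m₀ ≤ m ∧ ∃ 𝔮 : ∀ i, Ideal (lineRing T i 0),
      (∀ i, m ≤ i → (𝔮 i).IsPrime ∧ 𝔮 i ≠ maximalIdeal (lineRing T i 0) ∧ (𝔮 (i + 1)).comap (lineMap T i 0) = 𝔮 i) ∧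
      ringKrullDim (lineRing T m 0 ⧸ 𝔮 m) = 1 := by
  obtain ⟨m, 𝔮, h𝔮, hd⟩ := h
  exact ⟨max m₀ m, le_max_left _ _, 𝔮, fun i hi => h𝔮 i ((le_max_right _ _).trans hi),
    (curveChain_dim_eq_one T g hB m 𝔮 h𝔮 hd _ (le_max_right _ _)).1⟩

/-- **EMBEDDED RESOLUTION OF THE FOLLOWED CURVE GERM BY THE POINT BLOW-UPS OF THE TOWER (kernel, δ-descent)**: along a
curve chain `(𝔮_i)_{i ≥ m}` of a forced tower the one-dimensional local domains `𝒪_{x_i}/𝔮_i` have finite normalisation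
(excellence of the stalks) and NON-INCREASING δ-invariant, strictly decreasing while `𝒪_{x_i}/𝔮_i` is singular; hence SOME
stage `i ≥ m` has `𝒪_{x_i}/𝔮_i` REGULAR (a discrete valuation ring).  (Sources: Kollar2007 §1.4, Alg. 1.100, Thm. 1.101;
Matsumura1987 Thm. 32.4 (G-ring ⇒ finite normalisation in dimension one); tree `tower_isGRing_stalk`.) -/
theorem exists_regular_curveStage (T : ForcedTower) (g : T.St 0 ⟶ Spec (.of k)) (hB : IsBase (T.St 0) g) (m : ℕ)
    (𝔮 : ∀ i, Ideal (lineRing T i 0))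
    (h𝔮 : ∀ i, m ≤ i → (𝔮 i).IsPrime ∧ 𝔮 i ≠ maximalIdeal (lineRing T i 0) ∧ (𝔮 (i + 1)).comap (lineMap T i 0) = 𝔮 i)
    (hd : ringKrullDim (lineRing T m 0 ⧸ 𝔮 m) = 1) :
    ∃ i, m ≤ i ∧ (𝔮 i).IsPrime ∧ ringKrullDim (lineRing T i 0 ⧸ 𝔮 i) = 1 ∧ IsRegularLocalRing (lineRing T i 0 ⧸ 𝔮 i) := by
  have hNR := tower_isLocallyNoetherian_isRegular T g hB
  haveI : ∀ i, IsLocallyNoetherian (T.St i) := fun i => (hNR i).1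
  -- one blow-up step along the chain (`curveChain_step`) and the first stage (`curveChain_finite_base`)
  have step := fun i hi hdi hfi => curveChain_step T g hB m 𝔮 h𝔮 i hi hdi hfi
  haveI hPm : (𝔮 m).IsPrime := (h𝔮 m le_rfl).1
  haveI : IsLocalRing (lineRing T m 0 ⧸ 𝔮 m) :=
    IsLocalRing.of_surjective' (Ideal.Quotient.mk (𝔮 m)) Ideal.Quotient.mk_surjective
  haveI hfm : Module.Finite (lineRing T m 0 ⧸ 𝔮 m)
      (integralClosure (lineRing T m 0 ⧸ 𝔮 m) (FractionRing (lineRing T m 0 ⧸ 𝔮 m))) :=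
    curveChain_finite_base T g hB m (𝔮 m) hd
  have hδ : branchDelta (lineRing T m 0) (𝔮 m) ≠ ⊤ := by
    rw [branchDelta_eq]; exact curveDelta_ne_top _ hd
  obtain ⟨d, hdδ⟩ := ENat.ne_top_iff_exists.mp hδ
  -- δ-descent: induction on a bound `d` for `δ`
  suffices H : ∀ d : ℕ, ∀ i, m ≤ i → ringKrullDim (lineRing T i 0 ⧸ 𝔮 i) = 1 →
      Module.Finite (lineRing T i 0 ⧸ 𝔮 i)
        (integralClosure (lineRing T i 0 ⧸ 𝔮 i) (FractionRing (lineRing T i 0 ⧸ 𝔮 i))) →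
      branchDelta (lineRing T i 0) (𝔮 i) ≤ d →
      ∃ i', m ≤ i' ∧ (𝔮 i').IsPrime ∧ ringKrullDim (lineRing T i' 0 ⧸ 𝔮 i') = 1 ∧
        IsRegularLocalRing (lineRing T i' 0 ⧸ 𝔮 i') from H d m le_rfl hd hfm hdδ.symm.le
  intro d
  induction d with
  | zero =>
    intro i hi hdi hfi hle
    obtain ⟨-, -, hδle, hδeq⟩ := step i hi hdi hfi
    have h0 : branchDelta (lineRing T i 0) (𝔮 i) = 0 := nonpos_iff_eq_zero.mp (by simpa using hle)
    have h0' : branchDelta (lineRing T (i + 1) 0) (𝔮 (i + 1)) = 0 := nonpos_iff_eq_zero.mp (hδle.trans h0.le)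
    exact ⟨i, hi, (h𝔮 i hi).1, hdi, hδeq (h0'.trans h0.symm)⟩
  | succ d ih =>
    intro i hi hdi hfi hle
    obtain ⟨hd', hf', hδle, hδeq⟩ := step i hi hdi hfi
    by_cases heq : branchDelta (lineRing T (i + 1) 0) (𝔮 (i + 1)) = branchDelta (lineRing T i 0) (𝔮 i)
    · exact ⟨i, hi, (h𝔮 i hi).1, hdi, hδeq heq⟩
    · have hlt : branchDelta (lineRing T (i + 1) 0) (𝔮 (i + 1)) < (d : ℕ∞) + 1 := by
        rw [← Nat.cast_succ]; exact (lt_of_le_of_ne hδle heq).trans_le hle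
      exact ih (i + 1) (Nat.le_succ_of_le hi) hd' hf' (Order.le_of_lt_add_one hlt)

/-- **THE LINE BRIDGE (kernel)**: if at some stage `i₀` of a curve chain of a forced threefold tower the followed germ
`𝒪_{x_{i₀}}/𝔮_{i₀}` is REGULAR, the tower FOLLOWS A LINE from stage `i₀` on (`FollowsLineTower`, g35): `𝔮_{i₀} = (y₂, y₃)`
is part of a regular system of parameters `(u; y₂, y₃)` (Literature `exists_isRsopPart_fin_span_range_eq`), and step by step
(`curveLine_step`, dependent choice) the blow-up chart is the `u`-chart at its origin with parameters `(u; y₂/u, y₃/u)`,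
`y_l/u ∈ 𝔮_{i+1}`.  (Sources: CossartPiltant2008 Lemma 4.3 (3); Matsumura1987 Thms. 14.2, 14.3, 17.8.) -/
theorem followsLineTower_of_regular_curveStage (T : ForcedTower) (g : T.St 0 ⟶ Spec (.of k)) (hB : IsBase (T.St 0) g)
    (h3 : ThreefoldTower T) (m : ℕ) (𝔮 : ∀ i, Ideal (lineRing T i 0))
    (h𝔮 : ∀ i, m ≤ i → (𝔮 i).IsPrime ∧ 𝔮 i ≠ maximalIdeal (lineRing T i 0) ∧ (𝔮 (i + 1)).comap (lineMap T i 0) = 𝔮 i)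
    (i₀ : ℕ) (hi₀ : m ≤ i₀) (hd : ringKrullDim (lineRing T i₀ 0 ⧸ 𝔮 i₀) = 1)
    (hreg : IsRegularLocalRing (lineRing T i₀ 0 ⧸ 𝔮 i₀)) : FollowsLineTower T := by
  have hNR := tower_isLocallyNoetherian_isRegular T g hB
  haveI : ∀ i, IsLocallyNoetherian (T.St i) := fun i => (hNR i).1
  haveI hregR : ∀ j, IsRegularLocalRing (lineRing T i₀ j) := fun j => tower_isRegular T g hB (i₀ + j) _
  have hsf : ∀ j, (maximalIdeal (lineRing T i₀ j)).spanFinrank = 3 := fun j =>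
    tower_spanFinrank_eq_three_base T g hB h3 (i₀ + j)
  have hdim : ∀ j, ringKrullDim (lineRing T i₀ j) = 3 := fun j => by
    change ringKrullDim ((T.St (i₀ + j)).presheaf.stalk ((T.π (i₀ + j)).base (T.pt (i₀ + j + 1)))) = 3
    rw [T.pt_map]; exact ringKrullDim_eq_three_of_threefoldTower h3 (i₀ + j)
  -- the followed primes along the chain shifted to `i₀`
  let 𝔭 : ∀ j, Ideal (lineRing T i₀ j) := fun j => 𝔮 (i₀ + j)
  have h𝔭 : ∀ j, (𝔭 j).IsPrime ∧ 𝔭 j ≠ maximalIdeal (lineRing T i₀ j) ∧ (𝔭 (j + 1)).comap (lineMap T i₀ j) = 𝔭 j :=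
    fun j => curveChain_shift T m 𝔮 h𝔮 i₀ hi₀ j
  -- stage `i₀`: `𝔮_{i₀} = (y₂, y₃)` with `(u; y₂, y₃)` a regular system of parameters
  haveI hP₀ : (𝔮 i₀).IsPrime := (h𝔮 i₀ hi₀).1
  haveI := hreg
  obtain ⟨c, hcpart, hcq⟩ := exists_isRsopPart_fin_span_range_eq (R := lineRing T i₀ 0) (P := 𝔮 i₀)
    (IsLocalRing.le_maximalIdeal hP₀.ne_top) (r := 2) (by rw [hd, hdim 0]; rfl)
  obtain ⟨e, x, hsfe, hxspan, hxz⟩ := hcpart.exists_rsop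
  obtain rfl : e = 1 := by have := hsf 0; omega
  have hca0 : Fin.castAdd 1 (0 : Fin 2) = (0 : Fin (2 + 1)) := Fin.ext (by simp)
  have hca1 : Fin.castAdd 1 (1 : Fin 2) = (1 : Fin (2 + 1)) := Fin.ext (by simp)
  have hx0 : x 0 ∈ 𝔮 i₀ := by rw [← hca0, hxz 0, ← hcq]; exact Ideal.subset_span ⟨0, rfl⟩
  have hx1 : x 1 ∈ 𝔮 i₀ := by rw [← hca1, hxz 1, ← hcq]; exact Ideal.subset_span ⟨1, rfl⟩
  have hgen₀ : Ideal.span {x 2, x 0, x 1} = maximalIdeal (lineRing T i₀ 0) := by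
    rw [← hxspan, range_fin_three]
    congr 1
    ext z
    simp only [Set.mem_insert_iff, Set.mem_singleton_iff]
    tauto
  -- dependent choice along the chain
  obtain ⟨f, hGood, hRel⟩ := exists_seq_of_step (α := fun j => lineRing T i₀ j × lineRing T i₀ j × lineRing T i₀ j)
    (fun j a => Ideal.span {a.1, a.2.1, a.2.2} = maximalIdeal (lineRing T i₀ j) ∧ a.2.1 ∈ 𝔭 j ∧ a.2.2 ∈ 𝔭 j)
    (fun j a a' => lineMap T i₀ j a.1 = a'.1 ∧ lineMap T i₀ j a.2.1 = a'.1 * a'.2.1 ∧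
      lineMap T i₀ j a.2.2 = a'.1 * a'.2.2)
    (x 2, x 0, x 1) ⟨hgen₀, hx0, hx1⟩ (fun j a ha => by
      obtain ⟨hPj, hnej, hcomapj⟩ := h𝔭 j
      obtain ⟨hPj', -, -⟩ := h𝔭 (j + 1)
      haveI := hPj; haveI := hPj'
      obtain ⟨u', y₂', y₃', hgen', hu', hy₂', hy₃', hm₂, hm₃⟩ := curveLine_step (T.π (i₀ + j)) (T.pt (i₀ + j + 1))
        ((T.π (i₀ + j + 1)).base (T.pt (i₀ + j + 1 + 1))) (T.pt_map (i₀ + j + 1)) (tower_isClosed_base T (i₀ + j))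
        (tower_isBlowup_base T (i₀ + j)) (hsf j) (𝔭 j) hnej (𝔭 (j + 1)) hcomapj ha.1 ha.2.1 ha.2.2
      exact ⟨(u', y₂', y₃'), ⟨hgen', hm₂, hm₃⟩, hu', hy₂', hy₃'⟩)
  exact ⟨i₀, fun j => (f j).1, fun j => (f j).2.1, fun j => (f j).2.2, fun j => (hGood j).1, fun j => (hRel j).1,
    fun j => (hRel j).2.1, fun j => (hRel j).2.2⟩

/-- **THE CURVE-FOLLOWING LAW (KERNEL, PROVED, PORT-FREE; every `p`, every field, every class `P`, every weight `n`): NO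
forced tower of ring dimension 3 follows a curve germ.**  δ-descent (`exists_regular_curveStage`) + the line bridge
(`followsLineTower_of_regular_curveStage`) + the g35 LINE-FOLLOWING LAW `noTower_threefold_followsLine` BY NAME.
(Sources: Kollar2007 §1.4 Thm. 1.101; CossartPiltant2008 Lemma 4.3, proof of Prop. 4.4 p. 11; Matsumura1987 Thms. 14.2,
14.3, 17.8, 32.4.) -/
theorem noTower_threefold_followsCurve (n : ℕ) (P : ForcedTower → Prop) :
    NoTower n fun T => P T ∧ ThreefoldTower T ∧ FollowsCurveTower T := by
  intro p hp K _ _ T g hB hD hE hT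
  obtain ⟨hPT, h3, m, 𝔮, h𝔮, hd⟩ := hT
  obtain ⟨i₀, hi₀, -, hd₀, hreg⟩ := exists_regular_curveStage T g hB m 𝔮 h𝔮 hd
  exact noTower_threefold_followsLine n P p hp K T g hB hD hE
    ⟨hPT, h3, followsLineTower_of_regular_curveStage T g hB h3 m 𝔮 h𝔮 i₀ hi₀ hd₀ hreg⟩

/-- **THE CURVE-FOLLOWING LAW on the wild column** (`p ∣ n`). [folklore] -/
theorem noTowerWild_threefold_followsCurve (n : ℕ) (P : ForcedTower → Prop) :
    NoTowerWild n fun T => P T ∧ ThreefoldTower T ∧ FollowsCurveTower T := by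
  intro p hp hpn K _ _ T g hB hD hE hT
  exact noTower_threefold_followsCurve n P p hp K T g hB hD hE hT

end CurveLaw

end Summit.ResolutionOfSingularities.ResolutionOfSingularities.Theorems.HugValuationCut
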